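import Summits.HodgeConjecture.HodgeConjecture.Theorems.F0P3cStCharTSWeylCoreRadial        -- (this seat) §1 coset uniqueness + §2 «(WIF-σ)» on `M` in organ currency (over ★ p849950, LH2-p02 (g3))
import Summits.HodgeConjecture.HodgeConjecture.Theorems.F0P3cStCharTSShellWeight           -- ★ (LH1-p03 (g2)) «SHELL-WEIGHT★»: `vanDijkWeight_torusChart_of_not_mem = max(‖α‖, ‖α‖⁻¹)`, constancy on shells, `≠ 0`
import Summits.HodgeConjecture.HodgeConjecture.Theorems.F0P3cStCharTSTorusRay              -- ★ p849339 (LH6-p05 (g2)): the W-reflection `ω` (involution, measurable embedding), `M` second countable ∕ locally compact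
import Summits.HodgeConjecture.HodgeConjecture.Theorems.F0P3cStCharTSHyperbolicCore        -- ★ (F0P3a-p05 (g19)): (H3) `Ω° ⊆ hyperbolicSet`; brings ★ `…HyperbolicSet` (H2a)(H2b)(H2c)
import Summits.HodgeConjecture.HodgeConjecture.Theorems.F0P3cStCharTSShellFn               -- ★ p849538 (LH6-p05 (g2)): `valued_fst_reflect_apply`
import Literature.NumberTheory.Automorphic.OrbitalIntegralChartRealisation                    -- ★ `classOrbitalIntegral_mk_eq_zero_of_forall_conj_notMem_tsupport`
import Literature.NumberTheory.Automorphic.CMXiTorusCharSplitTorusDecay                         -- ★ `unitModulusChar_lt_one_of_forall_v_lt_one`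
import HarnessLib

/-!
# F0 · P3c · line LH6 «StCharTS» — road «W» (WEYL DISCHARGE), steps (B)+(C): THE WEYL INTEGRATION FORMULA ON THE TRACE-OPEN CORE `Ω°` WITH PRINT'S
# DENSITY `D_G = max(‖α‖, ‖α‖⁻¹)`, FROM THE RADIAL FORM AND THE HECKE SHELLS (Rogawski 1990 §12.5 p. 182, L. 12.7.2 (proof) p. 193; van Dijk 1972)

Cell `pub/hodgecm-mathlib`, crux H413 = `stmt-HodgeConjecture-24833` (`--supports` lane, helper), route HCCMUnconditional; seat LH6-p01 (g3), integrator of the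
(TOR) road.  THEOREMS ONLY, sorry-free, ★-only imports.  HONEST LABEL: HC_CM is proved only modulo the 7 printed citations (2 remaining: hLiu418 =
stmt-HodgeConjecture-24832, h413 = stmt-HodgeConjecture-24833) until rung 0 closes; this file closes no organ by itself — it turns the leaf's Weyl-integration
socket (WIF°) of ★ p850157 `…SaHeadTorus4` into a THEOREM modulo the per-shell data «SHELLS-TT» (the output of the Hecke-shell road: ★ GValue ∕ ★ DomGeneral ∕
★ `hshell_of_twoCoset`), with the EXPLICIT density `ρ(α, z) = max(‖α‖, ‖α‖⁻¹)` = print's `D_G` [L. 12.7.2 (proof) p. 193 «`D_G(γ) = ‖α‖⁻¹ = δ^{1∕2}(γ)⁻¹` for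
`‖α‖ < 1`»] = van Dijk's weight `Δ ∘ ι` off `M_c` (★ `vanDijkWeight_torusChart_of_not_mem`).

THE MATHEMATICS.  `G = U(Φ₃)(L⁺_v)` (`v` non-split, `w` the place above it), `T` the diagonal torus, `ι : M = E_vˣ × E¹_v ≃ T` the chart, `ω(α, z) = (σ(α)⁻¹, z)` the
W-reflection (`ι ∘ ω = ʷ(·) ∘ ι`), `M_c = 𝒪ˣ × E¹`, `Ω° = {γ | 1 < |(tr γ)_w|}` the trace-open core (`ι m ∈ Ω° ⟺ m ∉ M_c`).
The radial measure (`…WeylCoreRadial.exists_radialMeasure_torusParam`, over ★ `exists_radialMeasure_integral_mul_classFun`): `σ_M` on `M` with `∫_G φ·α dν =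
∫_M O(φ, ι m) α(ι m) dσ_M` for `α` conjugation-invariant; symmetrised, `τ := σ_M + ω_* σ_M`.  For a dominant chart point `u` (`|u₁|_w < 1`) and a level `n`, the shell datum
«SHELLS-TT» (a test function `φ` supported in `Ω°` with `F_φ = κ·(𝟙_{u M_n} + 𝟙_{u M_n} ∘ ω)` and total mass `∫ φ dν · ‖u₁‖ = 2κ·μ_M(u M_n)`) evaluates
`τ(u M_n) = max(‖u₁‖, ‖u₁‖⁻¹)² · μ_M(u M_n) ∕ μ_M(M_c)` (`F_φ = (2 μ_M(M_c))⁻¹·Δ∘ι·O`, `Δ(ι m) = max(‖α‖, ‖α‖⁻¹)` constant on the shell); the mirror cosets by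
`ω`-symmetry; coset uniqueness (`…WeylCoreRadial.restrict_eq_restrict_of_forall_smul_coe`) ⇒ `τ|_{M ∖ M_c} = (max(‖α‖, ‖α‖⁻¹)² ∕ μ_M(M_c)) · μ_M |_{M ∖ M_c}`.
The head: for `α` measurable, locally integrable, conjugation-invariant on `Ω°` and `φ ∈ C_c^∞(G)` supported in `Ω°`:
**`∫_G φ α dν = ∫_M F_φ(m) · max(‖α_m‖, ‖α_m‖⁻¹) · α(ι m) dμ_M`** — (WIF°) of ★ p850157 at `ρ = max(‖α‖, ‖α‖⁻¹)`.

## References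
* [Rogawski1990] J. D. Rogawski, *Automorphic Representations of Unitary Groups in Three Variables*, Ann. of Math. Stud. 123 (1990): §12.5 p. 182; §12.7 L. 12.7.1 (proof)
  p. 191, L. 12.7.2 (proof) p. 193; §4.9 (4.9.4) p. 56.
* [vanDijk1972] G. van Dijk, *Computation of certain induced characters of p-adic groups*, Math. Ann. 199 (1972), §2, Thm. p. 237.
* [HarishChandra1970] Harish-Chandra, *Harmonic analysis on reductive p-adic groups*, LNM 162 (1970), Lemma 22, Lemma 42.
-/

set_option autoImplicit false
-- the mandated namespace has the single-problem summit's repeated segment (`HodgeConjecture.HodgeConjecture`)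
set_option linter.dupNamespace false

noncomputable section

open NumberField IsDedekindDomain MeasureTheory MeasureTheory.Measure Filter Topology Set
open scoped Matrix MatrixGroups NNReal ENNReal Pointwise
open Literature.NumberTheory.Rogawski1990 Literature.NumberTheory.Automorphic Literature.NumberTheory.Automorphic.UnitaryGroup
open Literature.MeasureTheory.Group
open Summit.HodgeConjecture.HodgeConjecture.Cruxes.H413.F0P3cStCharTSTorusDefs
open Summit.HodgeConjecture.HodgeConjecture.Cruxes.H413.F0P3cStCharTSTorusChartIso
open Summit.HodgeConjecture.HodgeConjecture.Cruxes.H413.F0P3cStCharTSTorusCompactPart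
open Summit.HodgeConjecture.HodgeConjecture.Cruxes.H413.F0P3cStCharTSTorusRay
open Summit.HodgeConjecture.HodgeConjecture.Cruxes.H413.F0P3cStCharTSHyperbolicSet
open Summit.HodgeConjecture.HodgeConjecture.Cruxes.H413.F0P3cStCharTSHyperbolicCore
open Summit.HodgeConjecture.HodgeConjecture.Cruxes.H413.F0P3cStCharTSVanDijkWeylSymm
open Summit.HodgeConjecture.HodgeConjecture.Cruxes.H413.F0P3cStCharTSShellWeight
open Summit.HodgeConjecture.HodgeConjecture.Cruxes.H413.F0P3cStCharTSShellFn
open Summit.HodgeConjecture.HodgeConjecture.Cruxes.H413.F0P3cStCharTSWeylCoreRadial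
open Summit.HodgeConjecture.HodgeConjecture.Cruxes.H413.F0P3cStCharTSTorusLevelBasis

namespace Summit.HodgeConjecture.HodgeConjecture.Cruxes.H413.F0P3cStCharTSWeylCoreDensity

/-! ## The Weyl integration formula on the trace-open core, density form, from the shells -/

section CM

variable (L : Type) [Field L] [NumberField L] [IsCMField L] (v : HeightOneSpectrum (𝓞 ↥(maximalRealSubfield L)))

set_option maxHeartbeats 3200000 in
set_option synthInstance.maxHeartbeats 400000 in
-- long statement + instance transport between the organ carrier `Gqs L v` and the matrix carrier (cf. ★ p849653, ★ p849841)
/-- **THE WEYL INTEGRATION FORMULA ON THE TRACE-OPEN CORE `Ω°`, DENSITY FORM, FROM THE HECKE SHELLS — (WIF°) of ★ p850157 `…SaHeadTorus4` AT PRINT'S DENSITY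
`ρ = max(‖α‖, ‖α‖⁻¹) = D_G`.**  `v` non-split, `w ∣ v`; `νQv` a Haar measure on `U(Φ₃)(L⁺_v)` with canonical orbital measures `mQv`; `μM` any Haar measure on
`M = E_vˣ × E¹_v`; `Mlev` a nested family of open subgroups of `M` inside `M_c`, stable under the W-reflection, forming a neighbourhood basis of `1`; «SHELLS-TT» (`hSH`): for
every dominant chart point `u` (`|u₁|_w < 1`) and every level `n` a test function `φ` supported in `Ω°` with torus transform `κ·(𝟙_{u·Mlev n} + 𝟙_{u·Mlev n} ∘ ω)`,
`κ ≠ 0`, and total mass `∫ φ dν · ‖u₁‖ = 2κ·μM(u·Mlev n)` (the Hecke shell `𝟙_{K_n ι(u) K_n}`: ★ GValue + ★ `measureReal_doubleCoset_eq_card_mul`).  THEN for every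
measurable, locally integrable `α` conjugation-invariant on `Ω°` and every `φ ∈ C_c^∞` supported in `Ω°`:
**`∫ φ α dνQv = ∫_M torusTransform(φ)(m) · max(‖m₁‖, ‖m₁‖⁻¹) · α(ι m) dμM`.** [cite: Rogawski1990, §12.5 p. 182; §12.7 L. 12.7.2 (proof) p. 193; L. 12.7.1 (proof) p. 191]
[cite: vanDijk1972, §2] [cite: HarishChandra1970, Lemma 42] -/
theorem weylIntegration_core_of_shells
    (hns : ∀ w : PlacesOver L v, IsCMField.complexConj L • w.1 = w.1) (w : PlacesOver L v)
    [MeasurableSpace (Gqs L v)] [BorelSpace (Gqs L v)]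
    [∀ γ : Gqs L v, MeasurableSpace (Gqs L v ⧸ Subgroup.centralizer ({γ} : Set (Gqs L v)))]
    [∀ γ : Gqs L v, BorelSpace (Gqs L v ⧸ Subgroup.centralizer ({γ} : Set (Gqs L v)))]
    (νQv : Measure (Gqs L v)) [νQv.IsHaarMeasure] [νQv.IsMulRightInvariant]
    {mQv : OrbitalMeasureFamily (Gqs L v)}
    (hcanQ : mQv.IsCanonical (fun γ => IsRegularElt (γ.val : GL (Fin 3) (LocalRing L v))) νQv)
    [MeasurableSpace ((LocalRing L v)ˣ × ↥(normOneUnits (conjLocal L (IsCMField.complexConj L) v)))] [BorelSpace ((LocalRing L v)ˣ × ↥(normOneUnits (conjLocal L (IsCMField.complexConj L) v)))]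
    (μM : Measure ((LocalRing L v)ˣ × ↥(normOneUnits (conjLocal L (IsCMField.complexConj L) v)))) [μM.IsHaarMeasure]
    (Mlev : ℕ → Subgroup ((LocalRing L v)ˣ × ↥(normOneUnits (conjLocal L (IsCMField.complexConj L) v)))) (hMo : ∀ n, IsOpen (Mlev n : Set ((LocalRing L v)ˣ × ↥(normOneUnits (conjLocal L (IsCMField.complexConj L) v))))) (hMa : Antitone Mlev)
    (hMb : ∀ V ∈ 𝓝 (1 : ((LocalRing L v)ˣ × ↥(normOneUnits (conjLocal L (IsCMField.complexConj L) v)))), ∃ n, (Mlev n : Set ((LocalRing L v)ˣ × ↥(normOneUnits (conjLocal L (IsCMField.complexConj L) v)))) ⊆ V)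
    (hM0 : Mlev 0 ≤ (((Submonoid.pi Set.univ (fun w : PlacesOver L v => (w.1.adicCompletionIntegers L).toSubring.toSubmonoid)).units.prod (⊤ : Subgroup ↥(normOneUnits (conjLocal L (IsCMField.complexConj L) v)))) : Subgroup ((LocalRing L v)ˣ × ↥(normOneUnits (conjLocal L (IsCMField.complexConj L) v)))))
    (hMr : ∀ n, ∀ m ∈ Mlev n, (fun p : ((LocalRing L v)ˣ × ↥(normOneUnits (conjLocal L (IsCMField.complexConj L) v))) => ((Units.map ((conjLocal L (IsCMField.complexConj L) v : LocalRing L v →+* LocalRing L v) : LocalRing L v →* LocalRing L v) p.1)⁻¹, p.2)) m ∈ Mlev n)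
    (hSH : ∀ u : ((LocalRing L v)ˣ × ↥(normOneUnits (conjLocal L (IsCMField.complexConj L) v))), Valued.v ((u.1 : LocalRing L v) w) < 1 → ∀ n : ℕ,
      ∃ (φ : Gqs L v → ℂ) (κ : ℂ), κ ≠ 0 ∧ IsLocSmooth φ ∧ tsupport φ ⊆ {γ : Gqs L v | 1 < Valued.v ((Pi.evalRingHom (fun w' : PlacesOver L v => w'.1.adicCompletion L) w) ((γ.val : GL (Fin 3) (LocalRing L v)) : Matrix (Fin 3) (Fin 3) (LocalRing L v)).trace)} ∧
        (torusTransform L v mQv μM φ = fun m => κ * ((u • (Mlev n : Set ((LocalRing L v)ˣ × ↥(normOneUnits (conjLocal L (IsCMField.complexConj L) v))))).indicator (fun _ => (1 : ℂ)) m + (u • (Mlev n : Set ((LocalRing L v)ˣ × ↥(normOneUnits (conjLocal L (IsCMField.complexConj L) v))))).indicator (fun _ => (1 : ℂ)) ((fun p : ((LocalRing L v)ˣ × ↥(normOneUnits (conjLocal L (IsCMField.complexConj L) v))) => ((Units.map ((conjLocal L (IsCMField.complexConj L) v : LocalRing L v →+* LocalRing L v) : LocalRing L v →* LocalRing L v)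 p.1)⁻¹, p.2)) m))) ∧
        (∫ g, φ g ∂νQv) * (((unitModulusChar (LocalRing L v) u.1 : ℝ≥0) : ℝ) : ℂ) = 2 * κ * ((μM.real (u • (Mlev n : Set ((LocalRing L v)ˣ × ↥(normOneUnits (conjLocal L (IsCMField.complexConj L) v))))) : ℝ) : ℂ)) :
    ∀ α : Gqs L v → ℂ, Measurable α → LocallyIntegrable α νQv → (∀ g ∈ {γ : Gqs L v | 1 < Valued.v ((Pi.evalRingHom (fun w' : PlacesOver L v => w'.1.adicCompletion L) w) ((γ.val : GL (Fin 3) (LocalRing L v)) : Matrix (Fin 3) (Fin 3) (LocalRing L v)).trace)}, ∀ h : Gqs L v, α (h * g * h⁻¹) = α g) →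
      ∀ φ : Gqs L v → ℂ, IsLocSmooth φ → tsupport φ ⊆ {γ : Gqs L v | 1 < Valued.v ((Pi.evalRingHom (fun w' : PlacesOver L v => w'.1.adicCompletion L) w) ((γ.val : GL (Fin 3) (LocalRing L v)) : Matrix (Fin 3) (Fin 3) (LocalRing L v)).trace)} →
        ∫ g, φ g * α g ∂νQv = ∫ m, torusTransform L v mQv μM φ m * (((((max (unitModulusChar (LocalRing L v) m.1) (unitModulusChar (LocalRing L v) m.1)⁻¹ : ℝ≥0)) : ℝ) : ℂ) * α (((torusChart L v m : ↥(cmBorelTriple L 3 v).M) : ↥(unitaryGroupOfForm (conjLocal L (IsCMField.complexConj L) v) (cmLocalForm L 3 v))) : Gqs L v)) ∂μM := by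
  intro α hαm hαli hαinv φ hφ hsupp
  classical
  -- ═══ §a carriers, instances, names ═══
  haveI := locallyCompactSpace_torus L v
  haveI := secondCountableTopology_torus L v
  haveI hsub : Subsingleton (PlacesOver L v) := PlacesOver.subsingleton_of_smul_eq (IsCMField.complexConj L) (IsCMField.complexConj_ne_one L) w (hns w)
  set Mc : Subgroup ((LocalRing L v)ˣ × ↥(normOneUnits (conjLocal L (IsCMField.complexConj L) v))) := (((Submonoid.pi Set.univ (fun w : PlacesOver L v => (w.1.adicCompletionIntegers L).toSubring.toSubmonoid)).units.prod (⊤ : Subgroup ↥(normOneUnits (conjLocal L (IsCMField.complexConj L) v)))) : Subgroup ((LocalRing L v)ˣ × ↥(normOneUnits (conjLocal L (IsCMField.complexConj L) v)))) with hMcdef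
  set refl : ((LocalRing L v)ˣ × ↥(normOneUnits (conjLocal L (IsCMField.complexConj L) v))) → ((LocalRing L v)ˣ × ↥(normOneUnits (conjLocal L (IsCMField.complexConj L) v))) := (fun p : ((LocalRing L v)ˣ × ↥(normOneUnits (conjLocal L (IsCMField.complexConj L) v))) => ((Units.map ((conjLocal L (IsCMField.complexConj L) v : LocalRing L v →+* LocalRing L v) : LocalRing L v →* LocalRing L v) p.1)⁻¹, p.2)) with hrefldef
  set Ω : Set (Gqs L v) := {γ : Gqs L v | 1 < Valued.v ((Pi.evalRingHom (fun w' : PlacesOver L v => w'.1.adicCompletion L) w) ((γ.val : GL (Fin 3) (LocalRing L v)) : Matrix (Fin 3) (Fin 3) (LocalRing L v)).trace)} with hΩdef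
  -- ═══ §b the core `Ω°`, the compact part `M_c`, the reflection `ω` ═══
  have hΩhyp : Ω ⊆ hyperbolicSet L v := setOf_one_lt_v_trace_subset_hyperbolicSet L v hns w
  have hΩconj : ∀ g h : Gqs L v, h * g * h⁻¹ ∈ Ω ↔ g ∈ Ω := fun g h => conj_mem_setOf_one_lt_v_trace_iff L v w g h
  have hΩopen : IsOpen Ω := isOpen_setOf_one_lt_v_trace L v w
  have hmemMc : ∀ m : ((LocalRing L v)ˣ × ↥(normOneUnits (conjLocal L (IsCMField.complexConj L) v))), m ∈ Mc ↔ Valued.v ((m.1 : LocalRing L v) w) = 1 := by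
    intro m
    rw [hMcdef, Subgroup.mem_prod, mem_unitsIntegers_iff]
    simp only [Subgroup.mem_top, and_true]
    exact ⟨fun h => h w, fun h w' => (Subsingleton.elim w w') ▸ h⟩
  have hιΩ : ∀ m : ((LocalRing L v)ˣ × ↥(normOneUnits (conjLocal L (IsCMField.complexConj L) v))), (((torusChart L v m : ↥(cmBorelTriple L 3 v).M) : ↥(unitaryGroupOfForm (conjLocal L (IsCMField.complexConj L) v) (cmLocalForm L 3 v))) : Gqs L v) ∈ Ω ↔ m ∉ Mc := fun m => by
    rw [hmemMc]; exact one_lt_v_trace_torusChart_iff L v hns w m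
  have hreflMc : ∀ m : ((LocalRing L v)ˣ × ↥(normOneUnits (conjLocal L (IsCMField.complexConj L) v))), m ∈ Mc → refl m ∈ Mc := fun m hm => reflect_mem_torusCompactPart L v hns m hm
  have hrr : ∀ m : ((LocalRing L v)ˣ × ↥(normOneUnits (conjLocal L (IsCMField.complexConj L) v))), refl (refl m) = m := reflect_reflect L v
  have hreflmul : ∀ p q : ((LocalRing L v)ˣ × ↥(normOneUnits (conjLocal L (IsCMField.complexConj L) v))), refl (p * q) = refl p * refl q := reflect_mul L v
  have hreflv : ∀ m : ((LocalRing L v)ˣ × ↥(normOneUnits (conjLocal L (IsCMField.complexConj L) v))), Valued.v (((refl m).1 : LocalRing L v) w) = (Valued.v ((m.1 : LocalRing L v) w))⁻¹ := fun m => valued_fst_reflect_apply L v hns m w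
  have hreflme : MeasurableEmbedding refl := measurableEmbedding_reflect L v
  have hreflpre : ∀ s : Set ((LocalRing L v)ˣ × ↥(normOneUnits (conjLocal L (IsCMField.complexConj L) v))), refl ⁻¹' s = refl '' s := fun s => (image_reflect_eq_preimage L v s).symm
  have hreflMc' : ∀ m : ((LocalRing L v)ˣ × ↥(normOneUnits (conjLocal L (IsCMField.complexConj L) v))), m ∉ Mc → refl m ∉ Mc := fun m hm h => hm (by simpa only [hrr] using hreflMc _ h)
  obtain ⟨w₀, hw₀⟩ := exists_weylElt L v
  have hιrefl : ∀ m : ((LocalRing L v)ˣ × ↥(normOneUnits (conjLocal L (IsCMField.complexConj L) v))), ((torusChart L v (refl m) : ↥(cmBorelTriple L 3 v).M) : ↥(unitaryGroupOfForm (conjLocal L (IsCMField.complexConj L) v) (cmLocalForm L 3 v))) = w₀ * ((torusChart L v m : ↥(cmBorelTriple L 3 v).M) : ↥(unitaryGroupOfForm (conjLocal L (IsCMField.complexConj L) v) (cmLocalForm L 3 v))) * w₀⁻¹ := fun m => torusChart_reflect L v w₀ hw₀ m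
  -- the weight `Δ ∘ ι` and the modulus `‖·‖` of the first coordinate
  have hWrefl : ∀ m : ((LocalRing L v)ˣ × ↥(normOneUnits (conjLocal L (IsCMField.complexConj L) v))), vanDijkWeight L v (torusChart L v (refl m)) = vanDijkWeight L v (torusChart L v m) :=
    fun m => vanDijkWeight_weylConj L v w₀ hw₀ (torusChart L v m) _ (hιrefl m)
  have hWval : ∀ m : ((LocalRing L v)ˣ × ↥(normOneUnits (conjLocal L (IsCMField.complexConj L) v))), m ∉ Mc → vanDijkWeight L v (torusChart L v m) = ((((max (unitModulusChar (LocalRing L v) m.1) (unitModulusChar (LocalRing L v) m.1)⁻¹ : ℝ≥0)) : ℝ) : ℂ) := fun m hm => vanDijkWeight_torusChart_of_not_mem L v hns m hm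
  have hWne : ∀ m : ((LocalRing L v)ˣ × ↥(normOneUnits (conjLocal L (IsCMField.complexConj L) v))), m ∉ Mc → vanDijkWeight L v (torusChart L v m) ≠ 0 := fun m hm => vanDijkWeight_torusChart_ne_zero L v hns m hm
  have hWmul : ∀ m₀ : ((LocalRing L v)ˣ × ↥(normOneUnits (conjLocal L (IsCMField.complexConj L) v))), m₀ ∉ Mc → ∀ c ∈ Mc, vanDijkWeight L v (torusChart L v (m₀ * c)) = vanDijkWeight L v (torusChart L v m₀) :=
    fun m₀ hm₀ c hc => vanDijkWeight_torusChart_mul_of_mem L v hns m₀ hm₀ c hc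
  have hqone : ∀ c : ((LocalRing L v)ˣ × ↥(normOneUnits (conjLocal L (IsCMField.complexConj L) v))), c ∈ Mc → unitModulusChar (LocalRing L v) c.1 = 1 := fun c hc =>
    unitModulusChar_eq_one_of_forall_v_eq_one L v c.1 ((mem_unitsIntegers_iff L v c.1).1 (Subgroup.mem_prod.1 hc).1)
  have hqmul : ∀ m₀ : ((LocalRing L v)ˣ × ↥(normOneUnits (conjLocal L (IsCMField.complexConj L) v))), ∀ c ∈ Mc, unitModulusChar (LocalRing L v) (m₀ * c).1 = unitModulusChar (LocalRing L v) m₀.1 := by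
    intro m₀ c hc
    rw [Prod.fst_mul, map_mul, hqone c hc, mul_one]
  -- the density `D = max(‖α‖, ‖α‖⁻¹)`: constant on `M_c`-cosets, `ω`-symmetric, measurable
  set D : ((LocalRing L v)ˣ × ↥(normOneUnits (conjLocal L (IsCMField.complexConj L) v))) → ℝ≥0 := fun m => max (unitModulusChar (LocalRing L v) m.1) (unitModulusChar (LocalRing L v) m.1)⁻¹ with hDdef
  have hDmul : ∀ m₀ : ((LocalRing L v)ˣ × ↥(normOneUnits (conjLocal L (IsCMField.complexConj L) v))), ∀ c ∈ Mc, D (m₀ * c) = D m₀ := fun m₀ c hc => by simp only [hDdef, hqmul m₀ c hc]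
  have hDone : ∀ c : ((LocalRing L v)ˣ × ↥(normOneUnits (conjLocal L (IsCMField.complexConj L) v))), c ∈ Mc → D c = 1 := fun c hc => by simp only [hDdef, hqone c hc, inv_one, max_self]
  have hDrefl : ∀ m : ((LocalRing L v)ˣ × ↥(normOneUnits (conjLocal L (IsCMField.complexConj L) v))), D (refl m) = D m := by
    intro m
    by_cases hm : m ∈ Mc
    · rw [hDone m hm, hDone _ (hreflMc m hm)]
    · have h1 := hWval _ (hreflMc' m hm)
      rw [hWrefl, hWval m hm] at h1
      exact_mod_cast h1.symm
  have hDmeas : Measurable D := by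
    refine ((IsLocallyConstant.iff_exists_open D).2 fun m => ?_).continuous.measurable
    refine ⟨m • (Mc : Set ((LocalRing L v)ˣ × ↥(normOneUnits (conjLocal L (IsCMField.complexConj L) v)))), (isOpen_torusCompactPart L v).smul m, Set.mem_smul_set.2 ⟨1, Mc.one_mem, by rw [smul_eq_mul, mul_one]⟩, ?_⟩
    rintro _ ⟨c, hc, rfl⟩
    exact hDmul m c hc
  have hDpos : ∀ m : ((LocalRing L v)ˣ × ↥(normOneUnits (conjLocal L (IsCMField.complexConj L) v))), D m ≠ 0 := fun m => by
    have hq : unitModulusChar (LocalRing L v) m.1 ≠ 0 := by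
      rw [unitModulusChar_eq_normAbs L v w (hns w)]; exact normAbs_apply_ne_zero L v w m.1
    exact (lt_max_of_lt_left (pos_iff_ne_zero.2 hq)).ne'
  -- cosets of the levels: measurable, compact, inside `M ∖ M_c` or inside `M_c`
  have hMc_le : ∀ n, Mlev n ≤ Mc := fun n => (hMa (Nat.zero_le n)).trans hM0
  have hMcpt : ∀ n, IsCompact (Mlev n : Set ((LocalRing L v)ˣ × ↥(normOneUnits (conjLocal L (IsCMField.complexConj L) v)))) := fun n =>
    (isCompact_torusCompactPart L v hns).of_isClosed_subset ((Mlev n).isClosed_of_isOpen (hMo n)) (SetLike.coe_subset_coe.2 (hMc_le n))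
  have hcos_meas : ∀ (u : ((LocalRing L v)ˣ × ↥(normOneUnits (conjLocal L (IsCMField.complexConj L) v)))) (n : ℕ), MeasurableSet (u • (Mlev n : Set ((LocalRing L v)ˣ × ↥(normOneUnits (conjLocal L (IsCMField.complexConj L) v))))) := fun u n => (isOpen_smul_coe (hMo n) u).measurableSet
  have hcos_cpt : ∀ (u : ((LocalRing L v)ˣ × ↥(normOneUnits (conjLocal L (IsCMField.complexConj L) v)))) (n : ℕ), IsCompact (u • (Mlev n : Set ((LocalRing L v)ˣ × ↥(normOneUnits (conjLocal L (IsCMField.complexConj L) v))))) := fun u n => (hMcpt n).smul u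
  have hcos_out : ∀ u : ((LocalRing L v)ˣ × ↥(normOneUnits (conjLocal L (IsCMField.complexConj L) v))), u ∉ Mc → ∀ n, ∀ m ∈ u • (Mlev n : Set ((LocalRing L v)ˣ × ↥(normOneUnits (conjLocal L (IsCMField.complexConj L) v)))), m ∉ Mc := by
    rintro u hu n _ ⟨c, hc, rfl⟩ hm
    exact hu (by simpa only [smul_eq_mul, mul_inv_cancel_right] using Mc.mul_mem hm (Mc.inv_mem (hMc_le n hc)))
  have hMc_meas : MeasurableSet (Mc : Set ((LocalRing L v)ˣ × ↥(normOneUnits (conjLocal L (IsCMField.complexConj L) v)))) := (isOpen_torusCompactPart L v).measurableSet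
  have hμMc_top : μM (Mc : Set ((LocalRing L v)ˣ × ↥(normOneUnits (conjLocal L (IsCMField.complexConj L) v)))) ≠ ⊤ := (measure_torusCompactPart_lt_top L v hns μM).ne
  have hμMc_pos : 0 < μM.real (Mc : Set ((LocalRing L v)ˣ × ↥(normOneUnits (conjLocal L (IsCMField.complexConj L) v)))) := measure_real_torusCompactPart_pos L v μM (measure_torusCompactPart_lt_top L v hns μM)
  -- ═══ §c the radial measure («(WIF-σ)» on `M`, organ currency) and its `ω`-symmetrisation `τ` ═══
  obtain ⟨σM, hσMfin, hradM⟩ := exists_radialMeasure_torusParam L v hns νQv hcanQ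
  haveI := hσMfin
  set τ : Measure ((LocalRing L v)ˣ × ↥(normOneUnits (conjLocal L (IsCMField.complexConj L) v))) := σM + Measure.map refl σM with hτdef
  have hτapp : ∀ s : Set ((LocalRing L v)ˣ × ↥(normOneUnits (conjLocal L (IsCMField.complexConj L) v))), MeasurableSet s → τ s = σM s + σM (refl ⁻¹' s) := fun s hs => by
    rw [hτdef, Measure.add_apply, hreflme.map_apply]
  have hτfin : ∀ (u : ((LocalRing L v)ˣ × ↥(normOneUnits (conjLocal L (IsCMField.complexConj L) v)))) (n : ℕ), τ (u • (Mlev n : Set ((LocalRing L v)ˣ × ↥(normOneUnits (conjLocal L (IsCMField.complexConj L) v))))) ≠ ⊤ := fun u n => by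
    rw [hτapp _ (hcos_meas u n), hreflpre]
    exact ENNReal.add_ne_top.2 ⟨(hcos_cpt u n).measure_lt_top.ne, ((hcos_cpt u n).image (continuous_reflect L v)).measure_lt_top.ne⟩
  -- the torus transform, unfolded (★ p849564)
  have hTTdef : ∀ (ψ : Gqs L v → ℂ) (m : ((LocalRing L v)ˣ × ↥(normOneUnits (conjLocal L (IsCMField.complexConj L) v)))), torusTransform L v mQv μM ψ m =
      ((((2 * μM.real (Mc : Set ((LocalRing L v)ˣ × ↥(normOneUnits (conjLocal L (IsCMField.complexConj L) v)))))⁻¹ : ℝ)) : ℂ) * (vanDijkWeight L v (torusChart L v m) * classOrbitalIntegral mQv ψ (ConjClasses.mk (((torusChart L v m : ↥(cmBorelTriple L 3 v).M) : ↥(unitaryGroupOfForm (conjLocal L (IsCMField.complexConj L) v) (cmLocalForm L 3 v))) : Gqs L v))) := fun ψ m => rfl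
  set c₀ : ℂ := ((((2 * μM.real (Mc : Set ((LocalRing L v)ˣ × ↥(normOneUnits (conjLocal L (IsCMField.complexConj L) v)))))⁻¹ : ℝ)) : ℂ) with hc₀def
  have hc₀ne : c₀ ≠ 0 := by
    rw [hc₀def, Complex.ofReal_ne_zero]; exact inv_ne_zero (mul_ne_zero two_ne_zero hμMc_pos.ne')
  -- orbital integrals of a test function supported in `Ω°` vanish at the chart points of `M_c`
  have hOzero : ∀ ψ : Gqs L v → ℂ, tsupport ψ ⊆ Ω → ∀ m : ((LocalRing L v)ˣ × ↥(normOneUnits (conjLocal L (IsCMField.complexConj L) v))), m ∈ Mc → classOrbitalIntegral mQv ψ (ConjClasses.mk (((torusChart L v m : ↥(cmBorelTriple L 3 v).M) : ↥(unitaryGroupOfForm (conjLocal L (IsCMField.complexConj L) v) (cmLocalForm L 3 v))) : Gqs L v)) = 0 := by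
    intro ψ hψ m hm
    refine classOrbitalIntegral_mk_eq_zero_of_forall_conj_notMem_tsupport mQv fun y hy => ?_
    exact ((hιΩ m).1 ((hΩconj _ y).1 (hψ hy))) hm
  -- ═══ §d THE SHELL EVALUATION: `τ(u·Mlev n) = D(u)²·μM(u·Mlev n) ∕ μM(M_c)` for every dominant `u` ═══
  set ν' : Measure ((LocalRing L v)ˣ × ↥(normOneUnits (conjLocal L (IsCMField.complexConj L) v))) := (μM (Mc : Set ((LocalRing L v)ˣ × ↥(normOneUnits (conjLocal L (IsCMField.complexConj L) v)))))⁻¹ • μM.withDensity (fun m => ((D m ^ 2 : ℝ≥0) : ℝ≥0∞)) with hν'def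
  have hν'app : ∀ (u : ((LocalRing L v)ˣ × ↥(normOneUnits (conjLocal L (IsCMField.complexConj L) v)))) (n : ℕ), ν' (u • (Mlev n : Set ((LocalRing L v)ˣ × ↥(normOneUnits (conjLocal L (IsCMField.complexConj L) v))))) = (μM (Mc : Set ((LocalRing L v)ˣ × ↥(normOneUnits (conjLocal L (IsCMField.complexConj L) v)))))⁻¹ * (((D u ^ 2 : ℝ≥0) : ℝ≥0∞) * μM (u • (Mlev n : Set ((LocalRing L v)ˣ × ↥(normOneUnits (conjLocal L (IsCMField.complexConj L) v)))))) := by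
    intro u n
    rw [hν'def, Measure.smul_apply, smul_eq_mul, withDensity_apply _ (hcos_meas u n)]
    congr 1
    rw [← setLIntegral_const]
    refine setLIntegral_congr_fun (hcos_meas u n) fun m hm => ?_
    obtain ⟨c, hc, rfl⟩ := Set.mem_smul_set.1 hm
    rw [smul_eq_mul, hDmul u c (hMc_le n hc)]
  have hshell : ∀ u : ((LocalRing L v)ˣ × ↥(normOneUnits (conjLocal L (IsCMField.complexConj L) v))), Valued.v ((u.1 : LocalRing L v) w) < 1 → ∀ n : ℕ, τ (u • (Mlev n : Set ((LocalRing L v)ˣ × ↥(normOneUnits (conjLocal L (IsCMField.complexConj L) v))))) = ν' (u • (Mlev n : Set ((LocalRing L v)ˣ × ↥(normOneUnits (conjLocal L (IsCMField.complexConj L) v))))) := by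
    intro u hult n
    obtain ⟨φ₁, κ, hκ, hφ₁, hsupp₁, hTT, hmass⟩ := hSH u hult n
    have hu : u ∉ Mc := fun h => (ne_of_lt hult) ((hmemMc u).1 h)
    have hq1 : unitModulusChar (LocalRing L v) u.1 < 1 := unitModulusChar_lt_one_of_forall_v_lt_one L v u.1 fun w' => by
      rw [Subsingleton.elim w' w]; exact hult
    have hq0 : unitModulusChar (LocalRing L v) u.1 ≠ 0 := fun h => hDpos u (by simp only [hDdef, h, inv_zero, max_self])
    have hDu : D u = (unitModulusChar (LocalRing L v) u.1)⁻¹ := max_eq_right (hq1.le.trans (one_le_inv₀ (pos_iff_ne_zero.2 hq0) |>.2 hq1.le))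
    -- the orbital integral of the shell function along the chart: a two-coset step function
    set E : Set ((LocalRing L v)ˣ × ↥(normOneUnits (conjLocal L (IsCMField.complexConj L) v))) := u • (Mlev n : Set ((LocalRing L v)ˣ × ↥(normOneUnits (conjLocal L (IsCMField.complexConj L) v)))) with hEdef
    set K : ℂ := (c₀ * vanDijkWeight L v (torusChart L v u))⁻¹ * κ with hKdef
    have hWu : vanDijkWeight L v (torusChart L v u) ≠ 0 := hWne u hu
    have hOpt : ∀ m : ((LocalRing L v)ˣ × ↥(normOneUnits (conjLocal L (IsCMField.complexConj L) v))), classOrbitalIntegral mQv φ₁ (ConjClasses.mk (((torusChart L v m : ↥(cmBorelTriple L 3 v).M) : ↥(unitaryGroupOfForm (conjLocal L (IsCMField.complexConj L) v) (cmLocalForm L 3 v))) : Gqs L v)) = K * (E.indicator (fun _ => (1 : ℂ)) m + E.indicator (fun _ => (1 : ℂ)) (refl m)) := by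
      intro m
      have hTTm := congrFun hTT m
      rw [hTTdef] at hTTm
      by_cases hm : m ∈ Mc
      · -- both sides vanish
        have h1 : E.indicator (fun _ => (1 : ℂ)) m = 0 := Set.indicator_of_notMem (fun h => hcos_out u hu n m h hm) _
        have h2 : E.indicator (fun _ => (1 : ℂ)) (refl m) = 0 := Set.indicator_of_notMem (fun h => hcos_out u hu n _ h (hreflMc m hm)) _
        rw [hOzero φ₁ hsupp₁ m hm, h1, h2, add_zero, mul_zero]
      · -- off `M_c` the weight is invertible; where the step function is non-zero the weight equals its value at `u`
        by_cases hE : m ∈ E ∨ refl m ∈ E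
        · have hWm : vanDijkWeight L v (torusChart L v m) = vanDijkWeight L v (torusChart L v u) := by
            rcases hE with hE | hE
            · obtain ⟨c, hc, rfl⟩ := Set.mem_smul_set.1 hE
              rw [smul_eq_mul, hWmul u hu c (hMc_le n hc)]
            · obtain ⟨c, hc, hcm⟩ := Set.mem_smul_set.1 hE
              have : m = refl (u * c) := by rw [← smul_eq_mul, hcm, hrr]
              rw [this, hWrefl, hWmul u hu c (hMc_le n hc)]
          rw [hWm] at hTTm
          rw [hKdef]
          field_simp
          linear_combination hTTm
        · push Not at hE
          have h1 : E.indicator (fun _ => (1 : ℂ)) m = 0 := Set.indicator_of_notMem hE.1 _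
          have h2 : E.indicator (fun _ => (1 : ℂ)) (refl m) = 0 := Set.indicator_of_notMem hE.2 _
          rw [h1, h2, add_zero, mul_zero] at hTTm ⊢
          rcases mul_eq_zero.1 hTTm with h | h
          · exact absurd h hc₀ne
          · exact (mul_eq_zero.1 h).resolve_left (hWne m hm)
    -- the radial identity at `(φ₁, 1)`
    have hφ₁m : Measurable φ₁ := hφ₁.continuous.measurable
    have hint₁ : IntegrableOn (fun x => φ₁ x * (1 : ℂ)) (hyperbolicSet L v) νQv := by
      simp only [mul_one]; exact (hφ₁.continuous.integrable_of_hasCompactSupport hφ₁.hasCompactSupport).integrableOn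
    have hzero₁ : ∀ x : Gqs L v, x ∉ hyperbolicSet L v → φ₁ x = 0 := fun x hx => image_eq_zero_of_notMem_tsupport fun h => hx (hΩhyp (hsupp₁ h))
    obtain ⟨-, hrad₁⟩ := hradM φ₁ (fun _ => (1 : ℂ)) hφ₁m measurable_const (fun _ _ => rfl) hint₁ hzero₁
    simp only [mul_one] at hrad₁
    -- evaluate the right-hand side: `K · (σM(E) + σM(ω⁻¹ E)) = K · τ(E)`
    have hEm : MeasurableSet E := hcos_meas u n
    have hEfin : σM E ≠ ⊤ := (hcos_cpt u n).measure_lt_top.ne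
    have hE'fin : σM (refl ⁻¹' E) ≠ ⊤ := by rw [hreflpre]; exact ((hcos_cpt u n).image (continuous_reflect L v)).measure_lt_top.ne
    have hrhs : ∫ m : ((LocalRing L v)ˣ × ↥(normOneUnits (conjLocal L (IsCMField.complexConj L) v))), classOrbitalIntegral mQv φ₁ (ConjClasses.mk (((torusChart L v m : ↥(cmBorelTriple L 3 v).M) : ↥(unitaryGroupOfForm (conjLocal L (IsCMField.complexConj L) v) (cmLocalForm L 3 v))) : Gqs L v)) ∂σM = K * ((τ E).toReal : ℂ) := by
      simp_rw [hOpt]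
      rw [integral_const_mul, hτapp E hEm, ENNReal.toReal_add hEfin hE'fin, Complex.ofReal_add]
      congr 1
      have hi1 : Integrable (E.indicator fun _ => (1 : ℂ)) σM :=
        (integrableOn_const (C := (1 : ℂ)) hEfin).integrable_indicator hEm
      have hi2 : Integrable (fun m => E.indicator (fun _ => (1 : ℂ)) (refl m)) σM := by
        have : (fun m => E.indicator (fun _ => (1 : ℂ)) (refl m)) = (refl ⁻¹' E).indicator fun _ => (1 : ℂ) := by
          funext m; simp only [Set.indicator, Set.mem_preimage]
        rw [this]
        exact (integrableOn_const (C := (1 : ℂ)) hE'fin).integrable_indicator (hreflme.measurable hEm)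
      have hind : (fun m => E.indicator (fun _ => (1 : ℂ)) (refl m)) = (refl ⁻¹' E).indicator fun _ => (1 : ℂ) := by
        funext m; by_cases h : refl m ∈ E <;> simp [Set.indicator, h]
      rw [integral_add hi1 hi2, hind, integral_indicator_const _ hEm, integral_indicator_const _ (hreflme.measurable hEm)]
      simp only [measureReal_def, Complex.real_smul, mul_one]
    -- solve for `τ(E)`
    have hq0' : (((unitModulusChar (LocalRing L v) u.1 : ℝ≥0) : ℝ) : ℂ) ≠ 0 := by exact_mod_cast hq0
    have hMc0 : ((μM.real (Mc : Set ((LocalRing L v)ˣ × ↥(normOneUnits (conjLocal L (IsCMField.complexConj L) v)))) : ℝ) : ℂ) ≠ 0 := by exact_mod_cast hμMc_pos.ne'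
    have hWu' : vanDijkWeight L v (torusChart L v u) = (((D u : ℝ≥0) : ℝ) : ℂ) := hWval u hu
    have hqD : unitModulusChar (LocalRing L v) u.1 = (D u)⁻¹ := by rw [hDu, inv_inv]
    have hD0' : (((D u : ℝ≥0) : ℝ) : ℂ) ≠ 0 := by exact_mod_cast hDpos u
    have h1 : K * ((τ E).toReal : ℂ) * (((unitModulusChar (LocalRing L v) u.1 : ℝ≥0) : ℝ) : ℂ) = 2 * κ * ((μM.real E : ℝ) : ℂ) := by
      rw [← hrhs, ← hrad₁]; exact hmass
    have hτr : ((τ E).toReal : ℂ) = (((D u : ℝ≥0) : ℝ) : ℂ) ^ 2 / ((μM.real (Mc : Set ((LocalRing L v)ˣ × ↥(normOneUnits (conjLocal L (IsCMField.complexConj L) v)))) : ℝ) : ℂ) * ((μM.real E : ℝ) : ℂ) := by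
      rw [hKdef, hc₀def, hWu', hqD] at h1
      push_cast at h1 ⊢
      field_simp at h1
      field_simp
      linear_combination h1
    have hτE : τ E ≠ ⊤ := hτfin u n
    have hμMc0 : μM (Mc : Set ((LocalRing L v)ˣ × ↥(normOneUnits (conjLocal L (IsCMField.complexConj L) v)))) ≠ 0 := fun h => hμMc_pos.ne' (by rw [measureReal_def, h, ENNReal.toReal_zero])
    have hν'E : ν' E ≠ ⊤ := by
      rw [hν'app u n]
      exact ENNReal.mul_ne_top (ENNReal.inv_ne_top.2 hμMc0) (ENNReal.mul_ne_top (by simp) (hcos_cpt u n).measure_lt_top.ne)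
    refine (ENNReal.toReal_eq_toReal_iff' hτE hν'E).1 (Complex.ofReal_injective ?_)
    rw [hτr, hν'app u n, ENNReal.toReal_mul, ENNReal.toReal_mul, ENNReal.toReal_inv, ENNReal.coe_toReal, ← measureReal_def, ← measureReal_def]
    push_cast
    ring
  -- the mirror cosets: `τ` and `ν'` are `ω`-symmetric
  have hτsymm : ∀ s : Set ((LocalRing L v)ˣ × ↥(normOneUnits (conjLocal L (IsCMField.complexConj L) v))), MeasurableSet s → τ (refl ⁻¹' s) = τ s := by
    intro s hs
    rw [hτapp _ (hreflme.measurable hs), hτapp _ hs, ← Set.preimage_comp, show refl ∘ refl = id from funext hrr, Set.preimage_id, add_comm]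
  have hshell' : ∀ u : ((LocalRing L v)ˣ × ↥(normOneUnits (conjLocal L (IsCMField.complexConj L) v))), u ∉ Mc → ∀ n : ℕ, τ (u • (Mlev n : Set ((LocalRing L v)ˣ × ↥(normOneUnits (conjLocal L (IsCMField.complexConj L) v))))) = ν' (u • (Mlev n : Set ((LocalRing L v)ˣ × ↥(normOneUnits (conjLocal L (IsCMField.complexConj L) v))))) := by
    intro u hu n
    have hne : Valued.v ((u.1 : LocalRing L v) w) ≠ 1 := fun h => hu ((hmemMc u).2 h)
    rcases hne.lt_or_gt with hlt | hgt
    · exact hshell u hlt n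
    · have hlt' : Valued.v (((refl u).1 : LocalRing L v) w) < 1 := by rw [hreflv]; exact inv_lt_one_of_one_lt₀ hgt
      have h := hshell (refl u) hlt' n
      have hset : refl u • (Mlev n : Set ((LocalRing L v)ˣ × ↥(normOneUnits (conjLocal L (IsCMField.complexConj L) v)))) = refl ⁻¹' (u • (Mlev n : Set ((LocalRing L v)ˣ × ↥(normOneUnits (conjLocal L (IsCMField.complexConj L) v))))) := by
        ext m
        constructor
        · rintro ⟨c, hc, rfl⟩
          refine ⟨refl c, hMr n c hc, ?_⟩
          show u * refl c = refl (refl u * c)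
          rw [hreflmul, hrr]
        · rintro ⟨c, hc, hcm⟩
          refine ⟨refl c, hMr n c hc, ?_⟩
          have hcm' : u * c = refl m := hcm
          show refl u * refl c = m
          rw [← hreflmul, hcm', hrr]
      rw [hset, hτsymm _ (hcos_meas u n)] at h
      rw [h, ← hset, hν'app, hν'app, hDrefl, measure_smul, measure_smul]
  -- ═══ §e UNIQUENESS: `τ|_(M ∖ M_c) = ν'|_(M ∖ M_c)` (§1) ═══
  have hτν : τ.restrict ((Mc : Set ((LocalRing L v)ˣ × ↥(normOneUnits (conjLocal L (IsCMField.complexConj L) v))))ᶜ) = ν'.restrict ((Mc : Set ((LocalRing L v)ˣ × ↥(normOneUnits (conjLocal L (IsCMField.complexConj L) v))))ᶜ) :=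
    restrict_eq_restrict_of_forall_smul_coe Mlev hMo hMa hMb (S := (Mc : Set ((LocalRing L v)ˣ × ↥(normOneUnits (conjLocal L (IsCMField.complexConj L) v))))ᶜ)
      (fun u hu m hm => hcos_out u hu 0 m hm) τ ν' hτfin (fun u hu n => hshell' u hu n)
  -- ═══ §f THE HEAD: `∫ φ α = ∫_M O(φ, ι m) α'(ι m) dσ_M = ½ ∫ … dτ = ½ (μM M_c)⁻¹ ∫_(M ∖ M_c) D² … dμM = ∫ F_φ · D · α∘ι dμM` ═══
  set α' : Gqs L v → ℂ := Ω.indicator α with hα'def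
  have hα'm : Measurable α' := hαm.indicator hΩopen.measurableSet
  have hα'inv : ∀ x h : Gqs L v, α' (h * x * h⁻¹) = α' x := by
    intro x h
    by_cases hx : x ∈ Ω
    · rw [hα'def, Set.indicator_of_mem ((hΩconj x h).2 hx), Set.indicator_of_mem hx, hαinv x hx h]
    · rw [hα'def, Set.indicator_of_notMem (fun h' => hx ((hΩconj x h).1 h')), Set.indicator_of_notMem hx]
  have hφα : (fun g => φ g * α g) = fun g => φ g * α' g := by
    funext g
    by_cases hg : g ∈ Ω
    · rw [hα'def, Set.indicator_of_mem hg]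
    · rw [image_eq_zero_of_notMem_tsupport (fun h => hg (hsupp h)), zero_mul, zero_mul]
  have hint : IntegrableOn (fun x => φ x * α' x) (hyperbolicSet L v) νQv := by
    have h := (hαli.indicator hΩopen.measurableSet).integrable_smul_left_of_hasCompactSupport hφ.continuous hφ.hasCompactSupport
    simp only [smul_eq_mul] at h
    exact h.integrableOn
  have hzero : ∀ x : Gqs L v, x ∉ hyperbolicSet L v → φ x = 0 := fun x hx => image_eq_zero_of_notMem_tsupport fun h => hx (hΩhyp (hsupp h))
  obtain ⟨hgI, hgEq⟩ := hradM φ α' hφ.continuous.measurable hα'm hα'inv hint hzero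
  rw [hφα, hgEq]
  set g : ((LocalRing L v)ˣ × ↥(normOneUnits (conjLocal L (IsCMField.complexConj L) v))) → ℂ := fun m => classOrbitalIntegral mQv φ (ConjClasses.mk (((torusChart L v m : ↥(cmBorelTriple L 3 v).M) : ↥(unitaryGroupOfForm (conjLocal L (IsCMField.complexConj L) v) (cmLocalForm L 3 v))) : Gqs L v)) * α' (((torusChart L v m : ↥(cmBorelTriple L 3 v).M) : ↥(unitaryGroupOfForm (conjLocal L (IsCMField.complexConj L) v) (cmLocalForm L 3 v))) : Gqs L v) with hgdef
  have hg0 : ∀ m : ((LocalRing L v)ˣ × ↥(normOneUnits (conjLocal L (IsCMField.complexConj L) v))), m ∈ Mc → g m = 0 := fun m hm => by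
    have h0 : α' (((torusChart L v m : ↥(cmBorelTriple L 3 v).M) : ↥(unitaryGroupOfForm (conjLocal L (IsCMField.complexConj L) v) (cmLocalForm L 3 v))) : Gqs L v) = 0 := Set.indicator_of_notMem (fun h => ((hιΩ m).1 h) hm) _
    simp only [hgdef, h0, mul_zero]
  have hgrefl : ∀ m : ((LocalRing L v)ˣ × ↥(normOneUnits (conjLocal L (IsCMField.complexConj L) v))), g (refl m) = g m := fun m => by
    simp only [hgdef]
    rw [classOrbitalIntegral_gqs_weylConj L v w₀ mQv φ (torusChart L v m) _ (hιrefl m)]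
    congr 1
    exact (congrArg α' (congrArg (fun x : ↥(unitaryGroupOfForm (conjLocal L (IsCMField.complexConj L) v) (cmLocalForm L 3 v)) => (x : Gqs L v)) (hιrefl m))).trans (hα'inv _ _)
  -- `∫ g dτ = 2 ∫ g dσ_M`
  have hgI' : Integrable g (Measure.map refl σM) := by
    rw [hreflme.integrable_map_iff]
    exact hgI.congr (Eventually.of_forall fun m => (hgrefl m).symm)
  have h2 : ∫ m, g m ∂τ = 2 * ∫ m, g m ∂σM := by
    rw [hτdef, integral_add_measure hgI hgI', hreflme.integral_map]
    simp only [hgrefl]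
    ring
  -- `∫ g dτ = ∫_(M ∖ M_c) g dν'`
  have hg0' : ∀ m : ((LocalRing L v)ˣ × ↥(normOneUnits (conjLocal L (IsCMField.complexConj L) v))), m ∉ (Mc : Set ((LocalRing L v)ˣ × ↥(normOneUnits (conjLocal L (IsCMField.complexConj L) v))))ᶜ → g m = 0 := fun m hm => hg0 m (Set.notMem_compl_iff.1 hm)
  have h3 : ∫ m, g m ∂τ = ∫ m in (Mc : Set ((LocalRing L v)ˣ × ↥(normOneUnits (conjLocal L (IsCMField.complexConj L) v))))ᶜ, g m ∂ν' := by
    rw [← setIntegral_eq_integral_of_forall_compl_eq_zero (μ := τ) (s := (Mc : Set ((LocalRing L v)ˣ × ↥(normOneUnits (conjLocal L (IsCMField.complexConj L) v))))ᶜ) hg0']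
    show ∫ m, g m ∂(τ.restrict _) = ∫ m, g m ∂(ν'.restrict _)
    rw [hτν]
  -- `∫_(M ∖ M_c) g dν' = (μM M_c)⁻¹ ∫_M D² • g dμM`
  have hDm2 : Measurable fun m : ((LocalRing L v)ˣ × ↥(normOneUnits (conjLocal L (IsCMField.complexConj L) v))) => (D m) ^ 2 := hDmeas.pow_const 2
  have hDg0 : ∀ m : ((LocalRing L v)ˣ × ↥(normOneUnits (conjLocal L (IsCMField.complexConj L) v))), m ∉ (Mc : Set ((LocalRing L v)ˣ × ↥(normOneUnits (conjLocal L (IsCMField.complexConj L) v))))ᶜ → (D m ^ 2) • g m = 0 := fun m hm => by rw [hg0' m hm, smul_zero]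
  have h4 : ∫ m in (Mc : Set ((LocalRing L v)ˣ × ↥(normOneUnits (conjLocal L (IsCMField.complexConj L) v))))ᶜ, g m ∂ν' = ((μM (Mc : Set ((LocalRing L v)ˣ × ↥(normOneUnits (conjLocal L (IsCMField.complexConj L) v)))))⁻¹).toReal • ∫ m, (D m ^ 2) • g m ∂μM := by
    rw [hν'def, Measure.restrict_smul, integral_smul_measure, setIntegral_withDensity_eq_setIntegral_smul hDm2 _ hMc_meas.compl,
      setIntegral_eq_integral_of_forall_compl_eq_zero hDg0]
  -- the integrand of the right-hand side
  have h5 : ∀ m : ((LocalRing L v)ˣ × ↥(normOneUnits (conjLocal L (IsCMField.complexConj L) v))), torusTransform L v mQv μM φ m * (((((max (unitModulusChar (LocalRing L v) m.1) (unitModulusChar (LocalRing L v) m.1)⁻¹ : ℝ≥0)) : ℝ) : ℂ) * α (((torusChart L v m : ↥(cmBorelTriple L 3 v).M) : ↥(unitaryGroupOfForm (conjLocal L (IsCMField.complexConj L) v) (cmLocalForm L 3 v))) : Gqs L v)) =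
      (2 : ℂ)⁻¹ * (((((μM (Mc : Set ((LocalRing L v)ˣ × ↥(normOneUnits (conjLocal L (IsCMField.complexConj L) v)))))⁻¹).toReal : ℝ) : ℂ) * ((D m ^ 2) • g m)) := by
    intro m
    rw [hTTdef, hc₀def, ENNReal.toReal_inv, ← measureReal_def]
    by_cases hm : m ∈ Mc
    · rw [hOzero φ hsupp m hm, hg0 m hm, mul_zero, mul_zero, zero_mul, smul_zero, mul_zero, mul_zero]
    · have hα'eq : α' (((torusChart L v m : ↥(cmBorelTriple L 3 v).M) : ↥(unitaryGroupOfForm (conjLocal L (IsCMField.complexConj L) v) (cmLocalForm L 3 v))) : Gqs L v) = α (((torusChart L v m : ↥(cmBorelTriple L 3 v).M) : ↥(unitaryGroupOfForm (conjLocal L (IsCMField.complexConj L) v) (cmLocalForm L 3 v))) : Gqs L v) := Set.indicator_of_mem ((hιΩ m).2 hm) _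
      rw [hWval m hm, hgdef]
      simp only [hα'eq, NNReal.smul_def, Complex.real_smul, hDdef]
      push_cast
      ring
  have h6 : ∫ m, g m ∂σM = (2 : ℂ)⁻¹ * ∫ m, g m ∂τ := by
    rw [h2, ← mul_assoc, inv_mul_cancel₀ (two_ne_zero' ℂ), one_mul]
  rw [show (∫ m, classOrbitalIntegral mQv φ (ConjClasses.mk (((torusChart L v m : ↥(cmBorelTriple L 3 v).M) : ↥(unitaryGroupOfForm (conjLocal L (IsCMField.complexConj L) v) (cmLocalForm L 3 v))) : Gqs L v)) * α' (((torusChart L v m : ↥(cmBorelTriple L 3 v).M) : ↥(unitaryGroupOfForm (conjLocal L (IsCMField.complexConj L) v) (cmLocalForm L 3 v))) : Gqs L v) ∂σM) = ∫ m, g m ∂σM from rfl, h6, h3, h4]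
  simp_rw [h5]
  rw [integral_const_mul, integral_const_mul, Complex.real_smul]

end CM

end Summit.HodgeConjecture.HodgeConjecture.Cruxes.H413.F0P3cStCharTSWeylCoreDensity

end
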